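import Literature.AlgebraicTopology.SingularHomology.CohomologyRingChange
import Mathlib.Data.ZMod.Basic
import HarnessLib

/-!
# Stub `stub_bockstein` of line `Sketch` for crux stmt-HodgeConjecture-18466: Bockstein exactness modulo `m`

This file is stub `stub_bockstein` of line `Sketch` for the crux
`Summit.HodgeConjecture.HodgeConjecture.Theses.GenericDivisibility.HodgeClassesGenericallyDivisible`
(item stmt-HodgeConjecture-18466).  It proves, on an ARBITRARY topological space `E`, in every
degree `n` and for every modulus `m ≥ 1`, the elementary half of the Bockstein sequence
(A. Hatcher, *Algebraic Topology*, CUP 2002, §3.E p. 303: exactness of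
`Hⁿ(E; ℤ) →ᵐ Hⁿ(E; ℤ) → Hⁿ(E; ℤ/m)` at the middle term):

  `ker (Hⁿ(E; ℤ) → Hⁿ(E; ℤ/m)) ⊆ m · Hⁿ(E; ℤ)`,

i.e. an integral class whose reduction modulo `m` vanishes is `m` times an integral class.  The
tree's `Literature.AlgebraicTopology.SingularHomology.exists_eq_add_self_of_ringChange_eq_zero`
(`CohomologyRingChange.lean`) is the case `m = 2`; the proof below is its cochain-level argument
with `2` replaced by `m`: write `x = [φ]`; `φ mod m = δη̄` for a `ℤ/m`-cochain `η̄`; lift `η̄` to an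
integral cochain `η`; then `φ - δη` vanishes modulo `m`, so `φ - δη = m ψ` with `ψ` integral, and
`δψ = 0` because `m δψ = δ(m ψ) = δφ - δδη = 0` and integral cochains are torsion free; hence
`x = [φ] = [m ψ] = m [ψ]`.

Everything is proved (no `sorry`, no named facts); the helpers are prefixed
`genericDivisibility_sketch_`.

## References

* A. Hatcher, *Algebraic Topology*, CUP 2002, §3.1 p. 198 (change of coefficients), §3.E p. 303
  (Bockstein sequence). [HatcherAT2002]
-/

noncomputable section

open CategoryTheory

universe u

set_option linter.dupNamespace false

namespace Summit.HodgeConjecture.HodgeConjecture.Theorems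

open Literature.AlgebraicTopology.SingularHomology
open singularCochainComplex

variable {E : Type u} [TopologicalSpace E] {n : ℕ}

/-- `coFn (m • v) = m • coFn v`: the cochain of an `ℕ`-multiple of an integral cocycle. [folklore] -/
lemma genericDivisibility_sketch_coFn_nsmul (m : ℕ) (v : cocycles ℤ ℤ E n) :
    coFn (m • v) = m • coFn v := by
  induction m with
  | zero => rw [zero_nsmul, zero_nsmul, coFn_zero]
  | succ k ih => rw [succ_nsmul, succ_nsmul, coFn_add, ih]

/-- `δ (m • ψ) = m • δ ψ`: the coboundary commutes with `ℕ`-multiples. [folklore] -/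
lemma genericDivisibility_sketch_coboundary_nsmul (m : ℕ) (ψ : SingularSimplex E n → ℤ) :
    coboundary n (m • ψ) = m • coboundary n ψ := by
  induction m with
  | zero => rw [zero_nsmul, zero_nsmul, coboundary_zero]
  | succ k ih => rw [succ_nsmul, succ_nsmul, coboundary_add, ih]

/-- An integral cochain vanishing modulo `m` is `m` times an integral cochain (exactness of
`ℤ →ᵐ ℤ → ℤ/m` valuewise). [folklore] -/
lemma genericDivisibility_sketch_exists_eq_nsmul_of_comp_eq_zero (m : ℕ)
    (φ : SingularSimplex E n → ℤ) (h : (Int.castRingHom (ZMod m)) ∘ φ = 0) :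
    ∃ ψ : SingularSimplex E n → ℤ, φ = m • ψ := by
  refine ⟨fun σ => φ σ / m, funext fun σ => ?_⟩
  have hd : (m : ℤ) ∣ φ σ := (ZMod.intCast_zmod_eq_zero_iff_dvd (φ σ) m).1 (congrFun h σ)
  change φ σ = m • (φ σ / m)
  rw [nsmul_eq_mul, Int.mul_ediv_cancel' hd]

/-- `1/m` of an integral cocycle divisible by `m ≥ 1` is a cocycle (integral cochains are torsion
free). [folklore] -/
lemma genericDivisibility_sketch_coboundary_eq_zero_of_nsmul {m : ℕ} (hm : 1 ≤ m)
    {ψ : SingularSimplex E n → ℤ} (h : coboundary n (m • ψ) = 0) : coboundary n ψ = 0 := by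
  rw [genericDivisibility_sketch_coboundary_nsmul] at h
  funext σ
  have hσ : m • coboundary n ψ σ = 0 := congrFun h σ
  rw [nsmul_eq_mul] at hσ
  exact (mul_eq_zero.1 hσ).resolve_left (by omega)

/-- **Bockstein exactness modulo `m` (stub `stub_bockstein` of line `Sketch`).** On any
topological space `E`, in any degree `n`, for any `m ≥ 1`: an integral class `x ∈ Hⁿ(E; ℤ)` whose
reduction modulo `m` vanishes in `Hⁿ(E; ℤ/m)` is `m • y` for an integral class `y` — exactness of
the Bockstein sequence `Hⁿ(E; ℤ) →ᵐ Hⁿ(E; ℤ) → Hⁿ(E; ℤ/m)` at the middle term (Hatcher 2002,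
§3.E p. 303; elementary cochain proof: `x = [φ]`, `φ mod m = δη̄`, lift `η̄` to `η`, then
`φ - δη = m ψ` with `δψ = 0`, so `x = m [ψ]`). [cite: HatcherAT2002, §3.E p. 303] -/
theorem stub_bockstein : ∀ {E : Type u} [TopologicalSpace E] (n m : ℕ), 1 ≤ m →
    ∀ x : singularCohomology ℤ ℤ E n,
      singularCohomology.ringChange (Int.castRingHom (ZMod m)) E n x = 0 →
        ∃ y : singularCohomology ℤ ℤ E n, x = m • y := by
  intro E _ n m hm x hx
  induction x using singularCohomology_induction_on with
  | h u =>
    rw [singularCohomology.ringChange_π, ← map_zero (ConcreteCategory.hom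
      (singularCohomology.π (ZMod m) (ZMod m) E n))] at hx
    cases n with
    | zero =>
      have h0 := (singularCohomology.π_eq_π_iff_zero _ _).1 hx
      have hc : (Int.castRingHom (ZMod m)) ∘ coFn u = 0 := by
        rw [← coFn_cocyclesRingChange, h0, coFn_zero]
      obtain ⟨ψ, hψ⟩ := genericDivisibility_sketch_exists_eq_nsmul_of_comp_eq_zero m (coFn u) hc
      have hdψ : coboundary 0 ψ = 0 :=
        genericDivisibility_sketch_coboundary_eq_zero_of_nsmul hm (by rw [← hψ, coboundary_coFn])
      have hdψ' : (singularCochainComplex ℤ ℤ E).d 0 (0 + 1) ψ = 0 := hdψ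
      refine ⟨singularCohomology.π ℤ ℤ E 0 (cocyclesMk ψ hdψ'), ?_⟩
      rw [← map_nsmul]
      congr 1
      exact coFn_injective (by
        rw [hψ, genericDivisibility_sketch_coFn_nsmul, coFn_cocyclesMk])
    | succ k =>
      obtain ⟨wbar, hw⟩ := (singularCohomology.π_eq_π_iff_exists_coboundary _ _).1 hx
      rw [coFn_zero, sub_zero, coFn_cocyclesRingChange] at hw
      -- lift `wbar` to an integral cochain `w`
      let w : SingularSimplex E k → ℤ := fun σ => (ZMod.cast (wbar σ) : ℤ)
      have hwlift : (Int.castRingHom (ZMod m)) ∘ w = wbar := by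
        funext σ
        change (((ZMod.cast (wbar σ) : ℤ)) : ZMod m) = wbar σ
        exact ZMod.intCast_zmod_cast (wbar σ)
      -- `φ = u - δw` vanishes modulo `m`
      have hφ : (Int.castRingHom (ZMod m)) ∘ (coFn u - coboundary k w) = 0 := by
        have e : (Int.castRingHom (ZMod m)) ∘ (coFn u - coboundary k w) =
            (Int.castRingHom (ZMod m)) ∘ coFn u -
              (Int.castRingHom (ZMod m)) ∘ coboundary k w := by
          funext σ; exact map_sub _ _ _
        rw [e, ← coboundary_comp_ringHom, hwlift, hw, sub_self]
      obtain ⟨ψ, hψ⟩ := genericDivisibility_sketch_exists_eq_nsmul_of_comp_eq_zero m _ hφ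
      -- `ψ = (u - δw) / m` is a cocycle
      have hdψ : coboundary (k + 1) ψ = 0 :=
        genericDivisibility_sketch_coboundary_eq_zero_of_nsmul hm (by
          rw [← hψ, coboundary_sub, coboundary_coFn, coboundary_coboundary, sub_zero])
      have hdψ' : (singularCochainComplex ℤ ℤ E).d (k + 1) (k + 1 + 1) ψ = 0 := hdψ
      -- `[u] = [u - δw] = [m ψ] = m [ψ]`
      refine ⟨singularCohomology.π ℤ ℤ E (k + 1) (cocyclesMk ψ hdψ'), ?_⟩
      rw [← map_nsmul]
      refine (singularCohomology.π_eq_π_iff_exists_coboundary _ _).2 ⟨w, ?_⟩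
      rw [genericDivisibility_sketch_coFn_nsmul, coFn_cocyclesMk, ← hψ, sub_sub_cancel]

end Summit.HodgeConjecture.HodgeConjecture.Theorems
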